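import Mathlib
import HarnessLib
import Summits.AtomisticToContinuum.Crystallization.Theorems.HolmgrenBoyleLindHalfSpaceUniqueContinuationLayerOrbits

/-!
# Route `HolmgrenBoyleLind`: Lennard-Jones force fields of separated sources, part 11b —
vanishing structure factors empty a SIGNED layer (separately separated signs)

Support file for the crux item stmt-AtomisticToContinuum-6075 (`HalfSpaceUniqueContinuation`, line
`registered`, layered core; lead c3). Part 11 (`hbl_reps_layer_empty_of_structureFactors`) asks the
union `Dp ∪ Dm` of the two signed source sets to be `δ`-separated; for the symmetric difference of
two Delone sets only EACH sign is separated (a point of `ω ∖ ω'` may be arbitrarily close to a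
point of `ω' ∖ ω`). This file proves the same conclusion under separate separation hypotheses:

* `hbl_finsets_eq_empty_of_sum_echar_eq` — the core: two disjoint finite families of points of one
  height whose projections lie in `fdom Λ`, with equal character sums for every frequency, are both
  empty (independence of the characters of `(ℝ ∙ u)ᗮ / Λ`,
  `Literature.Analysis.Fourier.eq_zero_of_forall_sum_mul_cexp_eq_zero`);
* **`hbl_signedLayer_empty_of_structureFactors`** — `Dp`, `Dm` disjoint, each `Λ`-invariant, each
  `δ`-separated, each in `{⟪y,u⟫ ≥ a}`: equal structure factors of their representatives at height
  `η` for all `k` ⇒ no point of either at height `η`.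
All `[folklore]`; nothing here closes an item.
-/

noncomputable section

namespace Summit.AtomisticToContinuum.Crystallization.Theorems.HolmgrenBoyleLind

open scoped BigOperators Topology InnerProductSpace RealInnerProductSpace
open MeasureTheory Filter Set Literature.Algebra.EuclideanLattices.LatticePeriodic

/-- `z = P z + ⟪z, u⟫ u` for a unit vector `u` (projection onto the plane `(ℝ ∙ u)ᗮ`). [folklore] -/
theorem hbl_proj_add_inner_smul {u : EuclideanSpace ℝ (Fin 3)} (hu : ‖u‖ = 1)
    (z : EuclideanSpace ℝ (Fin 3)) :
    (((ℝ ∙ u)ᗮ.orthogonalProjectionOnto z : (ℝ ∙ u)ᗮ) : EuclideanSpace ℝ (Fin 3)) + ⟪z, u⟫ • u =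
      z := by
  rw [Submodule.orthogonalProjectionOnto_orthogonal, Submodule.coe_mk,
    Submodule.starProjection_unit_singleton ℝ hu, real_inner_comm, sub_add_cancel]

/-- `P (y + ℓ) = P y + ℓ` for `ℓ` in the plane. [folklore] -/
theorem hbl_proj_add_coe {u : EuclideanSpace ℝ (Fin 3)} (y : EuclideanSpace ℝ (Fin 3))
    (ℓ : (ℝ ∙ u)ᗮ) :
    (ℝ ∙ u)ᗮ.orthogonalProjectionOnto (y + ℓ) = (ℝ ∙ u)ᗮ.orthogonalProjectionOnto y + ℓ := by
  rw [map_add, Submodule.orthogonalProjectionOnto_mem_subspace_eq_self]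

/-- Two points of `fdom Λ` differing by a lattice vector are equal. [folklore] -/
theorem hbl_fdom_eq_of_sub_mem {u : EuclideanSpace ℝ (Fin 3)} (Λ : Submodule ℤ (ℝ ∙ u)ᗮ)
    [DiscreteTopology Λ] [IsZLattice ℝ Λ] {x x' : (ℝ ∙ u)ᗮ} (hx : x ∈ fdom Λ) (hx' : x' ∈ fdom Λ)
    (h : -x + x' ∈ Λ) : x = x' := by
  have ex : ZSpan.fract (rBasis Λ) x = x := ZSpan.fract_eq_self.2 hx
  have ex' : ZSpan.fract (rBasis Λ) x' = x' := ZSpan.fract_eq_self.2 hx'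
  rw [← ex, ← ex']
  exact (ZSpan.fract_eq_fract _ _ _).2 (by rwa [rBasis_span])

/-- **Canonical representative of an orbit** (public form of part 11's helper). For `y` in a
`Λ`-invariant `D` there are `q ∈ D` with `P q ∈ fdom Λ`, of the same height as `y`, and `ℓ ∈ Λ` with
`q + ℓ = y`. [folklore] -/
theorem hbl_exists_rep {u : EuclideanSpace ℝ (Fin 3)} (Λ : Submodule ℤ (ℝ ∙ u)ᗮ)
    [DiscreteTopology Λ] [IsZLattice ℝ Λ] {D : Set (EuclideanSpace ℝ (Fin 3))}
    (hD : ∀ ℓ : Λ, ∀ y : EuclideanSpace ℝ (Fin 3),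
      y + ((ℓ : (ℝ ∙ u)ᗮ) : EuclideanSpace ℝ (Fin 3)) ∈ D ↔ y ∈ D)
    {y : EuclideanSpace ℝ (Fin 3)} (hy : y ∈ D) :
    ∃ q : EuclideanSpace ℝ (Fin 3), ∃ ℓ : Λ,
      (q ∈ D ∧ (ℝ ∙ u)ᗮ.orthogonalProjectionOnto q ∈ fdom Λ) ∧
      ⟪q, u⟫ = ⟪y, u⟫ ∧ q + ((ℓ : (ℝ ∙ u)ᗮ) : EuclideanSpace ℝ (Fin 3)) = y := by
  set v : Submodule.span ℤ (Set.range (rBasis Λ)) :=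
    ZSpan.floor (rBasis Λ) ((ℝ ∙ u)ᗮ.orthogonalProjectionOnto y)
  set ℓ : Λ := ⟨(v : (ℝ ∙ u)ᗮ), (rBasis_span Λ).le v.2⟩
  refine ⟨y + (((-ℓ : Λ) : (ℝ ∙ u)ᗮ) : EuclideanSpace ℝ (Fin 3)), ℓ, ⟨(hD (-ℓ) y).2 hy, ?_⟩,
    ?_, ?_⟩
  · rw [hbl_proj_add_coe]
    have : (ℝ ∙ u)ᗮ.orthogonalProjectionOnto y + ((-ℓ : Λ) : (ℝ ∙ u)ᗮ) =
        ZSpan.fract (rBasis Λ) ((ℝ ∙ u)ᗮ.orthogonalProjectionOnto y) := by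
      rw [ZSpan.fract_apply, sub_eq_add_neg]
      rfl
    rw [this]
    exact ZSpan.fract_mem_fundamentalDomain _ _
  · rw [inner_add_left, Submodule.mem_orthogonal_singleton_iff_inner_left.1 (Submodule.coe_mem _),
      add_zero]
  · rw [add_assoc]
    simp

/-- **Core of the structure-factor argument.** Two disjoint finite families `Ap, Am ⊆ ℝ³` of points
of one height `η`, all with projection in `fdom Λ`, whose character sums agree for every frequency
(`∑_{Ap} e_{-k}(P q) = ∑_{Am} e_{-k}(P q)` for all `k`), are both empty: distinct points of one
height with projections in `fdom Λ` have projections distinct modulo `Λ`, and the characters of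
distinct points of the torus are linearly independent
(`Literature.Analysis.Fourier.eq_zero_of_forall_sum_mul_cexp_eq_zero`). [folklore] -/
theorem hbl_finsets_eq_empty_of_sum_echar_eq {u : EuclideanSpace ℝ (Fin 3)} (hu : ‖u‖ = 1)
    (Λ : Submodule ℤ (ℝ ∙ u)ᗮ) [DiscreteTopology Λ] [IsZLattice ℝ Λ]
    {Ap Am : Finset (EuclideanSpace ℝ (Fin 3))} {η : ℝ} (hdisj : Disjoint Ap Am)
    (hfd : ∀ q ∈ Ap ∪ Am, (ℝ ∙ u)ᗮ.orthogonalProjectionOnto q ∈ fdom Λ)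
    (hη : ∀ q ∈ Ap ∪ Am, ⟪q, u⟫ = η)
    (hSF : ∀ k : Fin (Module.finrank ℝ (ℝ ∙ u)ᗮ) → ℤ,
      ∑ q ∈ Ap, echar Λ (-k) ((ℝ ∙ u)ᗮ.orthogonalProjectionOnto q) =
        ∑ q ∈ Am, echar Λ (-k) ((ℝ ∙ u)ᗮ.orthogonalProjectionOnto q)) :
    Ap = ∅ ∧ Am = ∅ := by
  classical
  set s : Finset (EuclideanSpace ℝ (Fin 3)) := Ap ∪ Am with hs
  set e : {q // q ∈ s} ≃ Fin s.card := s.equivFin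
  set pt : Fin s.card → Fin (Module.finrank ℝ (ℝ ∙ u)ᗮ) → ℝ :=
    fun j i => (rBasis Λ).repr ((ℝ ∙ u)ᗮ.orthogonalProjectionOnto
      (e.symm j : EuclideanSpace ℝ (Fin 3))) i
  set c : Fin s.card → ℂ :=
    fun j => if ((e.symm j : {q // q ∈ s}) : EuclideanSpace ℝ (Fin 3)) ∈ Ap then 1 else -1
    with hc
  -- distinct representatives of one height have projections distinct modulo `Λ`
  have hq : ∀ i j : Fin s.card, i ≠ j → ∃ l, ¬ ∃ m : ℤ, pt i l - pt j l = m := by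
    intro i j hij
    by_contra hcon
    push Not at hcon
    apply hij
    have hmem : (ℝ ∙ u)ᗮ.orthogonalProjectionOnto
          ((e.symm i : {q // q ∈ s}) : EuclideanSpace ℝ (Fin 3)) -
        (ℝ ∙ u)ᗮ.orthogonalProjectionOnto
          ((e.symm j : {q // q ∈ s}) : EuclideanSpace ℝ (Fin 3)) ∈ Λ := by
      refine mem_of_rBasis_repr Λ fun l => ?_
      obtain ⟨m, hm⟩ := hcon l
      exact ⟨m, by rw [map_sub, Finsupp.sub_apply]; exact hm⟩
    have hP : (ℝ ∙ u)ᗮ.orthogonalProjectionOnto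
          ((e.symm j : {q // q ∈ s}) : EuclideanSpace ℝ (Fin 3)) =
        (ℝ ∙ u)ᗮ.orthogonalProjectionOnto
          ((e.symm i : {q // q ∈ s}) : EuclideanSpace ℝ (Fin 3)) :=
      hbl_fdom_eq_of_sub_mem Λ (hfd _ (e.symm j).2) (hfd _ (e.symm i).2)
        (by rwa [neg_add_eq_sub])
    have hpt' : ((e.symm j : {q // q ∈ s}) : EuclideanSpace ℝ (Fin 3)) = e.symm i := by
      rw [← hbl_proj_add_inner_smul hu ((e.symm j : {q // q ∈ s}) : EuclideanSpace ℝ (Fin 3)),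
        ← hbl_proj_add_inner_smul hu ((e.symm i : {q // q ∈ s}) : EuclideanSpace ℝ (Fin 3)), hP,
        hη _ (e.symm j).2, hη _ (e.symm i).2]
    exact (e.symm.injective (Subtype.ext hpt')).symm
  -- the vanishing of the signed structure factors, in coordinates
  have hzero := Literature.Analysis.Fourier.eq_zero_of_forall_sum_mul_cexp_eq_zero pt c hq ?_
  · have hsempty : s = ∅ := by
      by_contra hne
      obtain ⟨q, hqs⟩ := Finset.nonempty_iff_ne_empty.2 hne
      have h := hzero (e ⟨q, hqs⟩)
      simp only [hc, Equiv.symm_apply_apply] at h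
      split_ifs at h <;> norm_num at h
    exact Finset.union_eq_empty.1 hsempty
  · intro k
    have hchar : ∀ j : Fin s.card,
        Complex.exp (2 * Real.pi * Complex.I * ∑ l, ((k l : ℤ) : ℂ) * ((pt j l : ℝ) : ℂ)) =
          echar Λ k ((ℝ ∙ u)ᗮ.orthogonalProjectionOnto
            ((e.symm j : {q // q ∈ s}) : EuclideanSpace ℝ (Fin 3))) := by
      intro j
      rw [echar]
      congr 1; push_cast; rfl
    have hsum : ∑ j, c j * Complex.exp (2 * Real.pi * Complex.I *
          ∑ l, ((k l : ℤ) : ℂ) * ((pt j l : ℝ) : ℂ)) =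
        ∑ q ∈ s, (if q ∈ Ap then (1 : ℂ) else -1) *
          echar Λ k ((ℝ ∙ u)ᗮ.orthogonalProjectionOnto q) := by
      simp_rw [hchar]
      rw [← Finset.sum_coe_sort s]
      exact e.symm.sum_comp (fun q : {q // q ∈ s} =>
        (if (q : EuclideanSpace ℝ (Fin 3)) ∈ Ap then (1 : ℂ) else -1) *
          echar Λ k ((ℝ ∙ u)ᗮ.orthogonalProjectionOnto (q : EuclideanSpace ℝ (Fin 3))))
    rw [hsum, hs, Finset.sum_union hdisj]
    have h1 : ∑ q ∈ Ap, (if q ∈ Ap then (1 : ℂ) else -1) *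
          echar Λ k ((ℝ ∙ u)ᗮ.orthogonalProjectionOnto q) =
        ∑ q ∈ Ap, echar Λ k ((ℝ ∙ u)ᗮ.orthogonalProjectionOnto q) :=
      Finset.sum_congr rfl fun q hq => by rw [if_pos hq, one_mul]
    have h2 : ∑ q ∈ Am, (if q ∈ Ap then (1 : ℂ) else -1) *
          echar Λ k ((ℝ ∙ u)ᗮ.orthogonalProjectionOnto q) =
        -∑ q ∈ Am, echar Λ k ((ℝ ∙ u)ᗮ.orthogonalProjectionOnto q) := by
      rw [← Finset.sum_neg_distrib]
      exact Finset.sum_congr rfl fun q hq => by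
        rw [if_neg (Finset.disjoint_right.1 hdisj hq), neg_one_mul]
    rw [h1, h2, ← sub_eq_add_neg, sub_eq_zero]
    simpa using hSF (-k)

/-- **Vanishing structure factors empty a signed layer.** Let `Dp, Dm ⊆ ℝ³` be disjoint, each
invariant under the full lattice `Λ ≤ (ℝ ∙ u)ᗮ` (`‖u‖ = 1`), each `δ`-separated, each contained in
`{⟪y,u⟫ ≥ a}`. If at the height `η` the structure factors of their canonical representatives agree
for every integer frequency `k`, then neither set has a point at height `η`. [folklore] -/
theorem hbl_signedLayer_empty_of_structureFactors' {u : EuclideanSpace ℝ (Fin 3)} (hu : ‖u‖ = 1)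
    (Λ : Submodule ℤ (ℝ ∙ u)ᗮ) [DiscreteTopology Λ] [IsZLattice ℝ Λ]
    {Dp Dm : Set (EuclideanSpace ℝ (Fin 3))} {δ a : ℝ} (hδ : 0 < δ) (hdisj : Disjoint Dp Dm)
    (hsepp : ∀ x ∈ Dp, ∀ y ∈ Dp, x ≠ y → δ ≤ dist x y)
    (hsepm : ∀ x ∈ Dm, ∀ y ∈ Dm, x ≠ y → δ ≤ dist x y)
    (hap : ∀ y ∈ Dp, a ≤ ⟪y, u⟫) (ham : ∀ y ∈ Dm, a ≤ ⟪y, u⟫)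
    (hDp : ∀ ℓ : Λ, ∀ y : EuclideanSpace ℝ (Fin 3),
      y + ((ℓ : (ℝ ∙ u)ᗮ) : EuclideanSpace ℝ (Fin 3)) ∈ Dp ↔ y ∈ Dp)
    (hDm : ∀ ℓ : Λ, ∀ y : EuclideanSpace ℝ (Fin 3),
      y + ((ℓ : (ℝ ∙ u)ᗮ) : EuclideanSpace ℝ (Fin 3)) ∈ Dm ↔ y ∈ Dm) (η : ℝ)
    (hSF : ∀ k : Fin (Module.finrank ℝ (ℝ ∙ u)ᗮ) → ℤ,
      ∑ q ∈ (hbl_reps_height_finite hu Λ hδ hsepp hap η).toFinset with ⟪q, u⟫ = η,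
        echar Λ (-k) ((ℝ ∙ u)ᗮ.orthogonalProjectionOnto q) =
      ∑ q ∈ (hbl_reps_height_finite hu Λ hδ hsepm ham η).toFinset with ⟪q, u⟫ = η,
        echar Λ (-k) ((ℝ ∙ u)ᗮ.orthogonalProjectionOnto q)) :
    (∀ y ∈ Dp, ⟪y, u⟫ ≠ η) ∧ (∀ y ∈ Dm, ⟪y, u⟫ ≠ η) := by
  classical
  have key := hbl_finsets_eq_empty_of_sum_echar_eq (η := η) hu Λ ?_ ?_ ?_ hSF
  · refine ⟨fun y hy hyη => ?_, fun y hy hyη => ?_⟩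
    · obtain ⟨q, ℓ, hq, hqy, -⟩ := hbl_exists_rep Λ hDp hy
      refine Finset.notMem_empty q (key.1 ▸ Finset.mem_filter.2 ⟨?_, hqy.trans hyη⟩)
      exact (Set.Finite.mem_toFinset _).2 ⟨hq, (hqy.trans hyη).le⟩
    · obtain ⟨q, ℓ, hq, hqy, -⟩ := hbl_exists_rep Λ hDm hy
      refine Finset.notMem_empty q (key.2 ▸ Finset.mem_filter.2 ⟨?_, hqy.trans hyη⟩)
      exact (Set.Finite.mem_toFinset _).2 ⟨hq, (hqy.trans hyη).le⟩
  · refine Finset.disjoint_left.2 fun q hqp hqm => Set.disjoint_left.1 hdisj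
      ((Set.Finite.mem_toFinset _).1 (Finset.mem_filter.1 hqp).1).1.1
      ((Set.Finite.mem_toFinset _).1 (Finset.mem_filter.1 hqm).1).1.1
  · intro q hq
    rcases Finset.mem_union.1 hq with h | h <;>
      exact ((Set.Finite.mem_toFinset _).1 (Finset.mem_filter.1 h).1).1.2
  · intro q hq
    rcases Finset.mem_union.1 hq with h | h <;> exact (Finset.mem_filter.1 h).2

/-- **Vanishing structure factors empty a signed layer** (registered `∀`-form of
`hbl_signedLayer_empty_of_structureFactors'`). [folklore] -/
theorem hbl_signedLayer_empty_of_structureFactors : ∀ {u : EuclideanSpace ℝ (Fin 3)} (hu : ‖u‖ = 1) (Λ : Submodule ℤ (ℝ ∙ u)ᗮ) [DiscreteTopology Λ] [IsZLattice ℝ Λ] {Dp Dm : Set (EuclideanSpace ℝ (Fin 3))} {δ a : ℝ} (hδ : 0 < δ), Disjoint Dp Dm → ∀ (hsepp : ∀ x ∈ Dp, ∀ y ∈ Dp, x ≠ y → δ ≤ dist x y) (hsepm : ∀ x ∈ Dm, ∀ y ∈ Dm, x ≠ y → δ ≤ dist x y) (hap : ∀ y ∈ Dp, a ≤ inner ℝ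 y u) (ham : ∀ y ∈ Dm, a ≤ inner ℝ y u), (∀ ℓ : Λ, ∀ y : EuclideanSpace ℝ (Fin 3), y + ((ℓ : (ℝ ∙ u)ᗮ) : EuclideanSpace ℝ (Fin 3)) ∈ Dp ↔ y ∈ Dp) → (∀ ℓ : Λ, ∀ y : EuclideanSpace ℝ (Fin 3), y + ((ℓ : (ℝ ∙ u)ᗮ) : EuclideanSpace ℝ (Fin 3)) ∈ Dm ↔ y ∈ Dm) → ∀ η : ℝ, (∀ k : Fin (Module.finrank ℝ (ℝ ∙ u)ᗮ) → ℤ, ∑ q ∈ (Summit.AtomisticToContinuum.Crystallization.Theorems.HolmgrenBoyleLind.hbl_reps_height_finite hu Λ hδ hsepp hap η).toFinset with inner ℝ q u = η, Literature.Algebra.EuclideanLattices.LatticePeriodic.echar Λ (-k) ((ℝ ∙ u)ᗮ.orthogonalProjectionOnto q) = ∑ q ∈ (Summit.AtomisticToContinuum.Crystallization.Theorems.HolmgrenBoyleLind.hbl_reps_height_finite hu Λ hδ hsepm ham η).toFinset with inner ℝ q u = η, Literature.Algebra.EuclideanLattices.LatticePeriodic.echar Λ (-k) ((ℝ ∙ u)ᗮ.orthogonalProjectionOnto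 q)) → (∀ y ∈ Dp, inner ℝ y u ≠ η) ∧ (∀ y ∈ Dm, inner ℝ y u ≠ η) := by
  intro u hu Λ _ _ Dp Dm δ a hδ hdisj hsepp hsepm hap ham hDp hDm η hSF
  exact hbl_signedLayer_empty_of_structureFactors' hu Λ hδ hdisj hsepp hsepm hap ham hDp hDm η hSF

end Summit.AtomisticToContinuum.Crystallization.Theorems.HolmgrenBoyleLind

end
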